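import Mathlib
import HarnessLib
import Literature.MathematicalPhysics.QuantumLattice.FermiRG.BGM2003Sectors
import Summits.HubbardSuperconductivity.HubbardSuperconductivity.Theorems.KLProgrammeAbsUmklappTargetCount
import Summits.HubbardSuperconductivity.HubbardSuperconductivity.Theorems.KLProgrammeAbsUmklappTargetCountBound
import Summits.HubbardSuperconductivity.HubbardSuperconductivity.Theorems.KLProgrammeThinLevelSetDispersionChart

/-!
# Route `KLProgramme` — K3 engine (stmt-HubbardSuperconductivity-20437), stub (b) (ℓ)/(I2)–(I3), located item «ABS-UMK-COUNT»:
# BGM 2003 Lemma 3.1 WITH A TARGET VECTOR, ABSOLUTE FORM — `∃ c, #{target strings anchored at ω₁} ≤ c^L · 2^{n′(L−3)}` from `DispersionHyp` alone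

Cell gate-hubbard-kl, seat p4 g15 (capstone of the lineage's «ABS-UMK-COUNT» chain, memo HOME/prover-p4/ABS-UMK-COUNT-THEOREM.md).  All geometric hypotheses of
`AbsUmklappCount.card_targetStrings_le` are discharged from BGM 2003 §1.2 (`DispersionHyp`): the normal-angle data by `lemma71_normalAngle_holds`, the sector box
by `lemma73_sectorBox_holds`, the parallelogram lemma by `lemma75_parallelogram_holds`, the polar chart package by `ThinLevelSet.exists_fermiChart_of_dispersionHyp`;
the cone radius is fixed at `Φ₀ = min(Φ/2, s₁Φ/(96M₁))`; in the fine-scale regime `Q·L ≤ 2^{n′}` the bound is `≤ c_main^L·2^{n′(L−3)}` by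
`targetBound_le_pow`, and in the coarse regime `2^{n′} < Q·L` the trivial bound `(2·2^{n′})^L ≤ (16(Q³+1))^L·2^{n′(L−3)}` applies:

* **`count_target_abs_of_dispersionHyp`** — under `DispersionHyp ε μ e₀ u` there is `c > 0` such that for all `n′`, all `L ≥ 6`, every anchored leg
  `i₁` at `ω₁ < |O_{n′}|` and EVERY target vector `R`:
  `Nat.card {ω : ω_{i₁} = ω₁, ∃ k_i ∈ S_{n′,ω_i}, Σ k_i = R} ≤ c^L · 2^{n′(L−3)}`
  — the printed shape of Lemma 3.1 (4.3) at `h = 0`, for target strings, with no near-fibre loss.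

Everything is PROVED; no definitions, no named facts. [cite: BenfattoGiulianiMastropietro2003, §3.1 Lemma 3.1 (4.3) p.17 (L46–58) and §7.4 p.28]
-/

noncomputable section

open Real Set
open Literature.MathematicalPhysics.QuantumLattice Literature.MathematicalPhysics.QuantumLattice.FermiRG
open Literature.MathematicalPhysics.QuantumLattice.FermiRG.BGM2003
open Summit.HubbardSuperconductivity.HubbardSuperconductivity.Theorems.ThinLevelSet

namespace Summit.HubbardSuperconductivity.HubbardSuperconductivity.Theorems.AbsUmklappCount

set_option linter.dupNamespace false -- summit = problem name (single-conjunct summit), D-0017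

/-- The coarse case: `(2t)^L ≤ (16(Q³ + 1))^L · t^{L−3}` when `1 ≤ t < Q·L`, `L ≥ 3`, `Q ≥ 0`. [folklore] -/
theorem coarse_bound {L : ℕ} (hL : 3 ≤ L) {t Q : ℝ} (ht : 1 ≤ t) (hQ : 0 ≤ Q) (htQ : t ≤ Q * L) :
    (2 * t) ^ L ≤ (16 * (Q ^ 3 + 1)) ^ L * t ^ (L - 3) := by
  have ht0 : 0 < t := by linarith
  have hL1 : 1 ≤ L := by omega
  -- `L³ ≤ 8^L` (as `(2^L)³`; the tree's `LiSinai.cube_le_eight_pow` states the same, kept local here)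
  have hL3 : (L : ℝ) ^ 3 ≤ (8 : ℝ) ^ L := by
    have h1 : (L : ℝ) ≤ (2 : ℝ) ^ L := by exact_mod_cast (Nat.lt_two_pow_self (n := L)).le
    calc (L : ℝ) ^ 3 ≤ ((2 : ℝ) ^ L) ^ 3 := pow_le_pow_left₀ (Nat.cast_nonneg _) h1 3
      _ = (8 : ℝ) ^ L := by rw [← pow_mul, mul_comm, pow_mul]; norm_num
  have h1 : (2 * t) ^ L = 2 ^ L * t ^ 3 * t ^ (L - 3) := by
    rw [mul_pow, mul_assoc, ← pow_add]; congr 2; omega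
  have h2 : t ^ 3 ≤ Q ^ 3 * (8 : ℝ) ^ L := by
    calc t ^ 3 ≤ (Q * L) ^ 3 := pow_le_pow_left₀ ht0.le htQ 3
      _ = Q ^ 3 * (L : ℝ) ^ 3 := by rw [mul_pow]
      _ ≤ Q ^ 3 * (8 : ℝ) ^ L := mul_le_mul_of_nonneg_left hL3 (by positivity)
  have h3 : Q ^ 3 ≤ (Q ^ 3 + 1) ^ L := le_add_one_pow (by positivity) hL1
  rw [h1]
  calc (2 : ℝ) ^ L * t ^ 3 * t ^ (L - 3) ≤ 2 ^ L * (Q ^ 3 * 8 ^ L) * t ^ (L - 3) := by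
        exact mul_le_mul_of_nonneg_right (mul_le_mul_of_nonneg_left h2 (by positivity)) (by positivity)
    _ ≤ 2 ^ L * ((Q ^ 3 + 1) ^ L * 8 ^ L) * t ^ (L - 3) := by
        exact mul_le_mul_of_nonneg_right (mul_le_mul_of_nonneg_left (mul_le_mul_of_nonneg_right h3 (by positivity)) (by positivity))
          (by positivity)
    _ = (16 * (Q ^ 3 + 1)) ^ L * t ^ (L - 3) := by
        rw [mul_pow]
        have h16 : (16 : ℝ) ^ L = 2 ^ L * 8 ^ L := by rw [← mul_pow]; norm_num
        rw [h16]; ring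

set_option maxHeartbeats 400000 in -- constants are large closed terms; many positivity/regime side goals (200k is short)
/-- **BGM 2003 Lemma 3.1 with a target vector, absolute form, from `DispersionHyp` alone.**  See the module docstring.
[cite: BenfattoGiulianiMastropietro2003, §3.1 Lemma 3.1 (4.3) p.17 (L46–58) and §7.4 p.28 (L6–125)] -/
theorem count_target_abs_of_dispersionHyp {ε : (Fin 2 → ℝ) → ℝ} {μ e₀ : ℝ} {u : ℝ → ℝ → ℝ} (hD : DispersionHyp ε μ e₀ u) :
    ∃ c : ℝ, 0 < c ∧ ∀ (n' L : ℕ), 6 ≤ L → ∀ (i₁ : Fin L) (ω₁ : ℕ), ω₁ < sectorCount n' → ∀ R : Fin 2 → ℝ,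
      (Nat.card {ω : Fin L → Fin (sectorCount n') |
          (ω i₁ : ℕ) = ω₁ ∧ ∃ k : Fin L → (Fin 2 → ℝ), (∀ i, k i ∈ sSector u e₀ n' (ω i : ℕ)) ∧ ∑ i, k i = R} : ℝ) ≤
        c ^ L * (2 : ℝ) ^ (n' * (L - 3)) := by
  have hπ := Real.pi_pos
  have h0 : |(0 : ℝ)| ≤ e₀ := by rw [abs_zero]; exact hD.e₀_pos.le
  -- Lemma 7.1: the normal angle
  obtain ⟨c₁', c₂, hc₁', hc₁₂, h71⟩ := lemma71_normalAngle_holds ε μ e₀ u hD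
  obtain ⟨-, hlip', hpi'⟩ := h71 0 h0
  have hlip : ∀ θ₁ θ₂ : ℝ, FermiRG.torusDist (normalAngle u θ₂ 0 - normalAngle u θ₁ 0) ≤ c₂ * FermiRG.torusDist (θ₂ - θ₁) :=
    fun θ₁ θ₂ => (hlip' θ₁ θ₂).2
  have hpi : ∀ θ : ℝ, normalAngle u (θ + π) 0 = normalAngle u θ 0 + π := fun θ => by linarith [hpi' θ]
  have hc₂ : 0 ≤ c₂ := hc₁'.le.trans hc₁₂
  -- Lemma 7.3: the sector box
  obtain ⟨c₃, hc₃, h73⟩ := lemma73_sectorBox_holds ε μ e₀ u hD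
  -- the polar chart package
  obtain ⟨s₁, Φ, cf, Af, Bf, M₁, hs₁, hs₁M₁, hΦ, hcf, hcfA, hBf, hchart⟩ := exists_fermiChart_of_dispersionHyp hD
  have hM₁ : 0 < M₁ := hs₁.trans_le hs₁M₁
  have hAf : 0 < Af := hcf.trans_le hcfA
  -- Lemma 7.5 at `c_r = (2K₁ + 4c₂)/K₂`, `K₁ = 2 + c₂`
  set K₁ : ℝ := 2 + c₂ with hK₁
  have hK₁0 : 0 ≤ K₁ := by rw [hK₁]; positivity
  have hK₁pos : 0 < K₁ := by rw [hK₁]; positivity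
  set K₂ : ℝ := K₁ * π + 4 with hK₂
  have hK₂0 : 0 < K₂ := by rw [hK₂]; positivity
  have hcr : 0 < (2 * K₁ + 4 * c₂) / K₂ := by positivity
  obtain ⟨c₀, c₂', η₀, hc₀, hc₂', hη₀, h75⟩ := lemma75_parallelogram_holds ε μ e₀ u hD _ hcr
  -- the cone radius
  set Φ₀ : ℝ := min (Φ / 2) (s₁ * Φ / (96 * M₁)) with hΦ₀
  have hΦ₀pos : 0 < Φ₀ := by rw [hΦ₀]; exact lt_min (by positivity) (by positivity)
  have h2Φ₀ : 2 * Φ₀ ≤ Φ := by have := min_le_left (Φ / 2) (s₁ * Φ / (96 * M₁)); rw [← hΦ₀] at this; linarith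
  have hΦ₀M : 12 * M₁ * Φ₀ ≤ s₁ * Φ / 8 := by
    have h1 : Φ₀ ≤ s₁ * Φ / (96 * M₁) := by rw [hΦ₀]; exact min_le_right _ _
    have h2 : 12 * M₁ * (s₁ * Φ / (96 * M₁)) = s₁ * Φ / 8 := by field_simp; ring
    calc 12 * M₁ * Φ₀ ≤ 12 * M₁ * (s₁ * Φ / (96 * M₁)) := mul_le_mul_of_nonneg_left h1 (by positivity)
      _ = s₁ * Φ / 8 := h2
  -- the `L`-growth constants of `L_Ψ` and `B_fib`
  set a₅ : ℝ := 1 + c₂ * (π / 2) / (K₁ * Φ₀) with ha₅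
  have ha₅1 : 1 ≤ a₅ := by
    have h : 0 ≤ c₂ * (π / 2) / (K₁ * Φ₀) := by positivity
    rw [ha₅]; linarith
  set a₆ : ℝ := max ((2 * ((2 * c₀ * K₂ * c₃ / π + 1) * a₅)) ^ 2) (4 * c₃ ^ 2 * K₂ ^ 2 / η₀ ^ 2 * a₅ ^ 2) with ha₆
  have ha₆0 : 0 ≤ a₆ := by rw [ha₆]; exact le_max_of_le_left (sq_nonneg _)
  -- the threshold
  set Q : ℝ := 1 / Φ₀ + c₃ / Φ₀ + K₂ * a₅ * c₃ / (c₂' * Φ₀) + 8 * (12 * c₃ + s₁ * π) / (s₁ * Φ) with hQ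
  have hQ0 : 0 ≤ Q := by rw [hQ]; positivity
  -- the constant
  set E₁ : ℝ := (16 * c₃ / (s₁ * π) + 1) * (3840 * Af * (8 * c₃ * (1 + Bf) + (4 * Bf + 1) * s₁ * π / 2) / (cf ^ 2 * s₁ ^ 2 * π ^ 2)) with hE₁
  have hE₁0 : 0 ≤ E₁ := by rw [hE₁]; positivity
  set cmain : ℝ := 128 * (Φ₀ + 1) * (4 * E₁ + 1) + 384 * (a₆ + 1) with hcmain
  have hcmain0 : 0 < cmain := by rw [hcmain]; positivity
  set ccoarse : ℝ := 16 * (Q ^ 3 + 1) with hccoarse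
  have hccoarse0 : 0 < ccoarse := by rw [hccoarse]; positivity
  refine ⟨cmain + ccoarse, by positivity, ?_⟩
  intro n' L hL i₁ ω₁ hω₁ R
  set t : ℝ := (2 : ℝ) ^ n' with ht
  have ht1 : 1 ≤ t := one_le_pow₀ (by norm_num)
  have ht0 : 0 < t := by positivity
  have hz : (2 : ℝ) ^ (-(n' : ℤ)) = t⁻¹ := two_zpow_neg_eq_inv_pow n'
  have ht3 : t ^ (L - 3) = (2 : ℝ) ^ (n' * (L - 3)) := by rw [ht, ← pow_mul]
  have hL1 : (1 : ℝ) ≤ L := by exact_mod_cast (show 1 ≤ L by omega)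
  have hL0 : (0 : ℝ) < L := by linarith
  -- both partial constants are dominated by the total one
  have hpow_main : cmain ^ L ≤ (cmain + ccoarse) ^ L := pow_le_pow_left₀ hcmain0.le (by linarith) L
  have hpow_coarse : ccoarse ^ L ≤ (cmain + ccoarse) ^ L := pow_le_pow_left₀ hccoarse0.le (by linarith) L
  by_cases hreg : Q * L ≤ t
  · -- the fine-scale regime
    set LΨ : ℝ := L + c₂ * (π / 2) / (K₁ * Φ₀) with hLΨ
    have hLΨa : LΨ ≤ a₅ * L := by
      have h0 : 0 ≤ c₂ * (π / 2) / (K₁ * Φ₀) := by positivity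
      have h1 : c₂ * (π / 2) / (K₁ * Φ₀) ≤ c₂ * (π / 2) / (K₁ * Φ₀) * L := le_mul_of_one_le_right h0 hL1
      rw [hLΨ, ha₅]; linarith
    have hLΨ0 : 0 ≤ LΨ := by rw [hLΨ]; positivity
    set Bfib : ℝ := max ((2 * ((2 * c₀ * K₂ * c₃ / π + 1) * LΨ)) ^ 2) (4 * c₃ ^ 2 * K₂ ^ 2 / η₀ ^ 2 * LΨ ^ 2) with hBfib
    have hBfib_le : Bfib ≤ a₆ * (L : ℝ) ^ 2 := by
      rw [hBfib, ha₆]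
      refine max_le ?_ ?_
      · calc (2 * ((2 * c₀ * K₂ * c₃ / π + 1) * LΨ)) ^ 2 ≤ (2 * ((2 * c₀ * K₂ * c₃ / π + 1) * (a₅ * L))) ^ 2 := by
              apply pow_le_pow_left₀ (by positivity)
              exact mul_le_mul_of_nonneg_left (mul_le_mul_of_nonneg_left hLΨa (by positivity)) (by norm_num)
          _ = (2 * ((2 * c₀ * K₂ * c₃ / π + 1) * a₅)) ^ 2 * (L : ℝ) ^ 2 := by ring
          _ ≤ max ((2 * ((2 * c₀ * K₂ * c₃ / π + 1) * a₅)) ^ 2) (4 * c₃ ^ 2 * K₂ ^ 2 / η₀ ^ 2 * a₅ ^ 2) * (L : ℝ) ^ 2 :=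
              mul_le_mul_of_nonneg_right (le_max_left _ _) (by positivity)
      · calc 4 * c₃ ^ 2 * K₂ ^ 2 / η₀ ^ 2 * LΨ ^ 2 ≤ 4 * c₃ ^ 2 * K₂ ^ 2 / η₀ ^ 2 * (a₅ * L) ^ 2 :=
              mul_le_mul_of_nonneg_left (pow_le_pow_left₀ hLΨ0 hLΨa 2) (by positivity)
          _ = 4 * c₃ ^ 2 * K₂ ^ 2 / η₀ ^ 2 * a₅ ^ 2 * (L : ℝ) ^ 2 := by ring
          _ ≤ max ((2 * ((2 * c₀ * K₂ * c₃ / π + 1) * a₅)) ^ 2) (4 * c₃ ^ 2 * K₂ ^ 2 / η₀ ^ 2 * a₅ ^ 2) * (L : ℝ) ^ 2 :=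
              mul_le_mul_of_nonneg_right (le_max_right _ _) (by positivity)
    -- the four regime inequalities from the threshold
    have hQL1 : Q ≤ Q * L := le_mul_of_one_le_right hQ0 hL1
    have hQL : ∀ x : ℝ, 0 ≤ x → x ≤ Q → x ≤ t := fun x _ hxQ => by linarith
    have hq1 : 1 / Φ₀ ≤ Q := by
      have h : 0 ≤ c₃ / Φ₀ + K₂ * a₅ * c₃ / (c₂' * Φ₀) + 8 * (12 * c₃ + s₁ * π) / (s₁ * Φ) := by positivity
      rw [hQ]; linarith
    have hq2 : c₃ / Φ₀ ≤ Q := by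
      have h : 0 ≤ 1 / Φ₀ + K₂ * a₅ * c₃ / (c₂' * Φ₀) + 8 * (12 * c₃ + s₁ * π) / (s₁ * Φ) := by positivity
      rw [hQ]; linarith
    have hΦt : (2 : ℝ) ^ (-(n' : ℤ)) ≤ Φ₀ := by
      rw [hz, inv_le_comm₀ ht0 hΦ₀pos, ← one_div]; exact hQL _ (by positivity) hq1
    have hΦδ : c₃ * (2 : ℝ) ^ (-(n' : ℤ)) ≤ Φ₀ := by
      rw [hz, ← div_eq_mul_inv, div_le_iff₀ ht0]
      have h1 : c₃ / Φ₀ ≤ t := hQL _ (by positivity) hq2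
      rw [div_le_iff₀ hΦ₀pos] at h1; linarith
    have hΦη : K₂ * LΨ * (c₃ * (2 : ℝ) ^ (-(n' : ℤ))) ≤ c₂' * Φ₀ := by
      rw [hz]
      have h1 : K₂ * a₅ * c₃ / (c₂' * Φ₀) * L ≤ Q * L := by
        refine mul_le_mul_of_nonneg_right ?_ hL0.le
        have h : 0 ≤ 1 / Φ₀ + c₃ / Φ₀ + 8 * (12 * c₃ + s₁ * π) / (s₁ * Φ) := by positivity
        rw [hQ]; linarith
      have h2 : K₂ * a₅ * c₃ / (c₂' * Φ₀) * L ≤ t := h1.trans hreg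
      rw [div_mul_eq_mul_div, div_le_iff₀ (by positivity)] at h2
      rw [show K₂ * LΨ * (c₃ * t⁻¹) = K₂ * LΨ * c₃ / t by ring, div_le_iff₀ ht0]
      have h3 : K₂ * LΨ * c₃ ≤ K₂ * a₅ * c₃ * L := by
        have h4 := mul_le_mul_of_nonneg_right (mul_le_mul_of_nonneg_left hLΨa hK₂0.le) hc₃.le
        linarith [h4]
      linarith [h2, h3]
    have hreg' : 6 * (M₁ * (2 * Φ₀)) + 3 * (L * (4 * c₃ * (2 : ℝ) ^ (-(n' : ℤ)))) + 2 * (s₁ / 2 * sectorWidth n') ≤ s₁ / 4 * Φ := by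
      rw [hz, sectorWidth_eq_pi_div_pow, ← ht]
      have h1 : 8 * (12 * c₃ + s₁ * π) / (s₁ * Φ) * L ≤ t := by
        refine (mul_le_mul_of_nonneg_right ?_ hL0.le).trans hreg
        have h : 0 ≤ 1 / Φ₀ + c₃ / Φ₀ + K₂ * a₅ * c₃ / (c₂' * Φ₀) := by positivity
        rw [hQ]; linarith
      rw [div_mul_eq_mul_div, div_le_iff₀ (by positivity)] at h1
      have h2 : 6 * (M₁ * (2 * Φ₀)) + 3 * (L * (4 * c₃ * t⁻¹)) + 2 * (s₁ / 2 * (π / t)) = 12 * M₁ * Φ₀ + (12 * c₃ * L + s₁ * π) / t := by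
        field_simp; ring
      rw [h2]
      have h3 : (12 * c₃ * L + s₁ * π) / t ≤ s₁ * Φ / 8 := by
        rw [div_le_iff₀ ht0]
        have h4 : s₁ * π ≤ s₁ * π * L := le_mul_of_one_le_right (by positivity) hL1
        linarith [h4, h1]
      linarith [hΦ₀M, h3]
    have hmain := card_targetStrings_le hD hlip hpi hc₂ hc₃ h73 hK₁0 rfl hc₀ hc₂' hη₀ h75 hs₁ hM₁.le hΦ hcf hcfA hBf hchart hL i₁ hω₁ R
      hΦ₀pos.le h2Φ₀ (le_rfl : 2 + c₂ ≤ K₁) hLΨ hΦt hΦδ hΦη (le_rfl : _ ≤ Bfib) hreg'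
    have hbound := targetBound_le_pow (n' := n') hL hc₃ hs₁ hcf hAf hBf hΦ₀pos.le ha₆0 hBfib_le
    refine (hmain.trans hbound).trans ?_
    exact mul_le_mul_of_nonneg_right hpow_main (by positivity)
  · -- the coarse regime: the trivial bound
    have htQ : t ≤ Q * L := (not_le.1 hreg).le
    have hall : (Nat.card {ω : Fin L → Fin (sectorCount n') |
          (ω i₁ : ℕ) = ω₁ ∧ ∃ k : Fin L → (Fin 2 → ℝ), (∀ i, k i ∈ sSector u e₀ n' (ω i : ℕ)) ∧ ∑ i, k i = R} : ℝ) ≤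
        (2 * t) ^ L := by
      have h1 := Finite.card_subtype_le (fun ω : Fin L → Fin (sectorCount n') =>
        ω ∈ {ω : Fin L → Fin (sectorCount n') |
          (ω i₁ : ℕ) = ω₁ ∧ ∃ k : Fin L → (Fin 2 → ℝ), (∀ i, k i ∈ sSector u e₀ n' (ω i : ℕ)) ∧ ∑ i, k i = R})
      rw [Nat.card_eq_fintype_card (α := Fin L → Fin (sectorCount n')), Fintype.card_fun, Fintype.card_fin, Fintype.card_fin] at h1
      have h2 : ((Nat.card {ω : Fin L → Fin (sectorCount n') |
          (ω i₁ : ℕ) = ω₁ ∧ ∃ k : Fin L → (Fin 2 → ℝ), (∀ i, k i ∈ sSector u e₀ n' (ω i : ℕ)) ∧ ∑ i, k i = R} : ℕ) : ℝ) ≤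
          ((sectorCount n' ^ L : ℕ) : ℝ) := by exact_mod_cast h1
      refine h2.trans_eq ?_
      push_cast
      rw [sectorCount_eq_two_mul_pow]
    have hc := coarse_bound (by omega : 3 ≤ L) ht1 hQ0 htQ
    rw [← ht3]
    calc _ ≤ (2 * t) ^ L := hall
      _ ≤ (16 * (Q ^ 3 + 1)) ^ L * t ^ (L - 3) := hc
      _ ≤ (cmain + ccoarse) ^ L * t ^ (L - 3) := mul_le_mul_of_nonneg_right hpow_coarse (by positivity)

end Summit.HubbardSuperconductivity.HubbardSuperconductivity.Theorems.AbsUmklappCount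

end
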